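import Literature.NumberTheory.EllipticCurves.YanZhu2026.GreenbergMainTheoremsAnyRootGuarded
import HarnessLib

/-!
# Burungale–Castella–Skinner (IMRN 2025), proof of Prop. 4.2.2 with Conj. 4.1.2: at a prime `p > 2` of
# GOOD reduction (ordinary OR supersingular), the anticyclotomic projection of Greenberg's two-variable
# `p`-adic `L`-function `L_p^Gr(g/K)` generates the same ideal as `L_p^BDP(g/K)` — the reduction-type-free
# companion of the tree's ordinary twin `YanZhu2026.prop314_span_minus_eq_span_bdp_anyRoot_guarded`
# (Yan–Zhu Prop. 3.14 = CGS25 Prop. 2.4.5) and of the supersingular PREPRINT twin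
# `BurungaleSkinnerTianWan2024.prop627_span_minus_eq_span_bdp_supersingular_PRE` (BSTW Prop. 6.27 (i))

Written by the lead prover seat `bsd-line-sbc-p1` (gen 10) of route `SignedBaseChange` of the BSD summit
(host cell `pub/bsd-ssimc`), for the crux stmt-BirchSwinnertonDyer-20727 `AnticyclotomicEisensteinDivisibility`,
registered line `bdpline`, stub S3 `stub_minusIsBDP` ("`G⁻` IS a BDP `L`-function"): conjunct 8 of the
line's named-facts stub is, as of skeleton v33, the PREPRINT binder `prop627_…_supersingular_PRE`; this file
types the REFEREED sentence of Burungale–Castella–Skinner that carries the same comparison at every prime of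
good reduction. ONE named fact (`def … : Prop`, D-0014, statement only, hypotheses as printed, specialised
as documented), in EXACTLY the currency of the two siblings; nothing is asserted about any curve; no
`_holds`; no new notion.

## Printed statements

* **[BCS25] Prop. 4.2.2** (IMRN 2025 rnaf082 = arXiv:2405.00270v2, §4.2, p. 9 L2–L13): "Let `g ∈ S₂(Γ₀(N))`
  be an elliptic newform with good reduction at `p > 2`, and suppose `K` is an imaginary quadratic field
  satisfying (disc), (Heeg), (spl), and (irr_K). Then `μ(L_p^Gr(g/K)) = μ(L_p^BDP(g/K)) = 0`. *Proof.* By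
  [Hsi14, Thm. B], `L_p^BDP(g/K)` has vanishing `μ`-invariant. **Since a direct comparison of the
  interpolation properties shows that the projection of `L_p^Gr(g/K)` to `Λ_K^{−,ur}` generates the same
  ideal as `L_p^BDP(g/K)` (see [CGS23, Prop. 1.4.5]), the result follows.**" Hypotheses (§1.2, p. 2
  L34–L39): (disc) "`D_K` is odd and `D_K ≠ −3`"; (Heeg) "every prime `ℓ ∣ N` splits in `K`"; (spl)
  "`p = v v̄` splits in `K`"; (irr_K) `E[p]` irreducible as a `G_K`-module. The object `L_p^Gr(g/K)` at a
  prime of GOOD reduction (no ordinarity) is the one of BCS's **Conj. 4.1.2** (p. 8 L15–L24): "Let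
  `g ∈ S₂(Γ₀(N))` be a newform and `p > 2` a prime of good reduction for `g`. Let `K` be an imaginary
  quadratic field satisfying (spl). Then `X_Gr(g/K_∞)` is `Λ_K`-torsion, with `(L_p^Gr(g/K)) =
  ch_{Λ_K}(X_Gr(g/K_∞))` as ideals in `Λ_K^ur`."
* **[CGS25] Prop. 2.4.5** (Math. Ann. 393 = [CGS23] arXiv:2303.04373 Prop. 1.4.5, p. 9): "We have the
  equality `𝓛_p^Gr(f/K)⁻ · Λ_K^{−,ur} = 𝓛_p^BDP(f/K) · Λ_K^{−,ur}`. *Proof.* This follows from a direct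
  comparison of the interpolation formulas in Theorem 1.4.1 [Hida's two-variable `p`-adic Rankin
  `L`-series], Theorem 1.3.1 [BDP] and Theorem 1.4.2 [Katz], together with an application of Dirichlet's
  class number formula", with Def. 1.4.3 "`𝓛_p^Gr(f/K) := h_K · 𝓛_v(K)⁻ · 𝓛_p(f/K, Σ^{(2')})`" and
  "`𝓛_p^Gr(f/K)⁻` the image of `𝓛_p^Gr(f/K)` under the natural projection `Λ_K^ur → Λ_K^{−,ur}`".

## Transcription and READING FLAGS

VERBATIM the binder block of the sibling fact `BurungaleCastellaSkinner2025.prop422_greenbergAnyRoot_hasUnitContent_minus`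
(the SAME printed proposition, typed by the cell `bsd-wall` in the reading its proof establishes): `E = W/ℚ`
elliptic, globally minimal, newform `f` of level `N = N_E`, `2 < p`, `W.HasGoodReductionAtPrime p` (NO
ordinarity, NO supersingularity), `K` imaginary quadratic with (Heeg) (`SatisfiesHeegnerHypothesis`), (spl)
(`#primesOver p = 2`, `p ∈ v`, `p ∈ v̄`, `v̄ ≠ v`, `v` induced by `ι`), (disc), `(N, D_K) = 1`, (irr_K)
(`HasIrreducibleModPGaloisRep` of the base change); `(κ₁, κ₂)` the cyclotomic / anticyclotomic
`ℤ_p`-extensions with an adapted generator pair `(γ₁, γ₂)`; EVERY Katz frame with GENUINE period data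
(`Ω ≠ 0`, `δ² = ±D_K`, `Ω_p ∈ R₀ˣ`, `IsKatzMeasure₂ ι v v̄ ∅ κ₁ κ₂ γ₁⁻¹ γ₂⁻¹ 1 Ω δ Ω_p LK`) and EVERY `G` in
the any-root Greenberg value frame `IsGreenbergLFunctionAnyRoot₂ ι v v̄ κ₁ κ₂ γ₁⁻¹ γ₂⁻¹ f |D_K| h_K LK G` —
print's `L_p^Gr(g/K)` exactly as the sibling reads it. THEN, verbatim the frame/conclusion block of the
ordinary twin `prop314_span_minus_eq_span_bdp_anyRoot_guarded` (and of the supersingular PRE twin): for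
EVERY BDP frame `(Ω_K ≠ 0, Ω_p′, L)` at the plain anticyclotomic generator (`IsBDPLFunction ι v κ₂ γ₂ f Ω_K
Ω_p′ L`, Castella's normalisation — the tree's reading of `L_p^BDP`) and every structure-compatible
`J₀ : ℤ_p^ur → 𝒪_{ℂ_p}`: `Ideal.span {minus G} = Ideal.span {PowerSeries.map J₀ L}` in `𝒪_{ℂ_p}⟦T⟧`
(`minus = constantCoeff` kills the cyclotomic variable `T₁` = "the projection to `Λ_K^{−,ur}`"; signs, the
unit period ratios and the normalisation constants of the interpolation formulas are invisible at the level
of ideals — WEAKER than print).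

* Flag `BCS-422-comparison-via-CGS` (NEW, the one point a reader must know): the refereed source STATES the
  comparison at every prime of good reduction `p > 2` inside the proof of Prop. 4.2.2 and PROVES it by
  reference to [CGS23, Prop. 1.4.5], whose paper carries the standing hypothesis "`p ∤ 2N` of good ORDINARY
  reduction" (§1, p. 7); the printed proof of [CGS23, 1.4.5] ("direct comparison of the interpolation
  formulas … together with Dirichlet's class number formula") uses the BDP range of Hida's `p`-adic Rankin
  `L`-series (Thm. 1.4.1, the CM family in the dominant weight) and Katz's measure, in which the reduction
  type of `f` at `p` does not enter (the Euler factor `𝓔(ψ,f,1)` is symmetric in the two roots of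
  `x² − a_p x + p`). This is a CITATION-LEVEL gap of the refereed source, recorded, not repaired, here; the
  typed statement is BCS's sentence, not more. (Compare: the tree already books BCS Prop. 4.2.2's
  CONCLUSION `μ = 0` at every good prime as refereed — `prop422_greenbergAnyRoot_hasUnitContent_minus` —
  and that conclusion rests in print on this very comparison.)
* Flags inherited VERBATIM from the siblings: `BSTW-924-conjugate-convention` / `BSTW-2VS-frame` (the
  binder quantifies over ALL typed frames with genuine period data; two inhabited frames for the same field
  data differ by a unit, under which the ideal equality is invariant), `BSTW-627-normalisation` (BDP read
  through `IsBDPLFunction`), and the `(N, D_K) = 1` standing hypothesis of [CGS23] where `L_p^Gr` is built.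

RELATION TO THE SIBLINGS (no restatement): `prop314_…_anyRoot_guarded` = the ORDINARY case under
`GreenbergSetting` (which carries `GoodOrd`) WITHOUT (irr_K) — refereed (Yan–Zhu / CGS25);
`prop627_…_supersingular_PRE` = the case `a_p = 0`, `5 ≤ p` WITHOUT (irr_K) — preprint (BSTW 6.27 (i));
THIS = every good `p > 2` WITH (irr_K) and (disc) — refereed (BCS25), hypotheses exactly those of BCS
Prop. 4.2.2. Neither sibling implies or is implied by this binder (different hypothesis sets). WEAKER than
or equal to print in every binder; never knowingly stronger. WHAT IS NOT HERE: `μ = 0` (the sibling),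
BCS Thm. 4.2.1 / Conj. 4.1.2 themselves, anything at `p = 2`, general Hecke fields.

CONSUMER: on stmt-BirchSwinnertonDyer-20727 the derived stub `stub_minusIsBDP` at `a_p = 0` follows from
THIS ∧ `prop422_exists_isBDPLFunction_mu_eq_zero` (the line has (irr_K) from `Surj`, (disc), (Heeg),
`(N, D_K) = 1`, `p ≥ 5` good among the crux binders) — so conjunct 8 of `stub_namedFactsSS` can be
re-sourced from the preprint binder to this refereed one (lead's reshape v34; Summits side).

## References
* [BurungaleCastellaSkinner2025] A. Burungale, F. Castella, C. Skinner, *Base change and Iwasawa main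
  conjectures for GL₂*, IMRN 2025 (8), rnaf082 (= arXiv:2405.00270v2): Prop. 4.2.2 and its proof (§4.2,
  p. 9 L2–L13), Conj. 4.1.2 (p. 8 L15–L24), §1.2 (disc)/(Heeg)/(spl) (p. 2 L34–L39).
* [CastellaGrossiSkinner2025] F. Castella, G. Grossi, C. Skinner, *Mazur's main conjecture at Eisenstein
  primes*, Math. Ann. 393 (= arXiv:2303.04373): Prop. 2.4.5 (= 1.4.5) with its proof, Def. 2.4.3 (= 1.4.3),
  Thms. 1.3.1, 1.4.1, 1.4.2, §1 standing hypotheses (p. 7).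
* [Hsieh2014] M.-L. Hsieh, *Special values of anticyclotomic Rankin–Selberg L-functions*, Doc. Math. 19,
  Thm. B (as cited by BCS).
* Tree: `BurungaleCastellaSkinner2025/GreenbergMuInvariantGoodReduction.lean` (the sibling binder block),
  `YanZhu2026/GreenbergMainTheoremsAnyRootGuarded.lean` (ordinary twin, frame conventions),
  `BurungaleSkinnerTianWan2024/GreenbergBDPComparisonSupersingularPRE.lean` (supersingular PRE twin).
-/

noncomputable section

open scoped Classical

open PowerSeries NumberField IsDedekindDomain Field CongruenceSubgroup
  Literature.NumberTheory.GaloisRepresentations Literature.NumberTheory.EllipticCurves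
  Literature.NumberTheory.EllipticCurves.ModularForms Literature.NumberTheory.EllipticCurves.UnrSeries₂

namespace Literature.NumberTheory.EllipticCurves.BurungaleCastellaSkinner2025

/-- **Burungale–Castella–Skinner 2025 (IMRN, refereed), proof of Prop. 4.2.2 (§4.2, p. 9 L10–L13), with
Conj. 4.1.2 for the object: at a prime `p > 2` of GOOD reduction — ordinary or supersingular — "a direct
comparison of the interpolation properties shows that the projection of `L_p^Gr(g/K)` to `Λ_K^{−,ur}`
generates the same ideal as `L_p^BDP(g/K)` (see [CGS23, Prop. 1.4.5])"**, under the hypotheses of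
Prop. 4.2.2: "`g ∈ S₂(Γ₀(N))` an elliptic newform with good reduction at `p > 2`, `K` an imaginary
quadratic field satisfying (disc), (Heeg), (spl), and (irr_K)". TRANSCRIBED (module docstring): the binder
block of the sibling `prop422_greenbergAnyRoot_hasUnitContent_minus` VERBATIM (`E = W/ℚ` globally minimal
with newform `f` of level `N = N_E`, `2 < p`, `W.HasGoodReductionAtPrime p`, (Heeg), (spl) with `v` induced
by `ι`, (disc), `(N, D_K) = 1`, (irr_K); the (cyclotomic, anticyclotomic) tower with an adapted generator
pair; EVERY Katz frame with genuine period data and EVERY any-root Greenberg frame `G` over it = print's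
`L_p^Gr(g/K)`), then the BDP-frame / conclusion block of the ordinary twin
`YanZhu2026.prop314_span_minus_eq_span_bdp_anyRoot_guarded` VERBATIM: for EVERY BDP frame
`IsBDPLFunction ι v κ₂ γ₂ f Ω_K Ω_p′ L` (`Ω_K ≠ 0`) and every structure-compatible `J₀ : ℤ_p^ur → 𝒪_{ℂ_p}`,
`(minus G) = (J₀ L)` as ideals of `𝒪_{ℂ_p}⟦T⟧` (`minus` = "projection to `Λ_K^{−,ur}`"; signs / units /
normalisation constants absorbed — WEAKER than print). READING FLAG `BCS-422-comparison-via-CGS`: BCS prove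
the sentence by citing [CGS23, Prop. 1.4.5], printed under CGS's ordinary standing hypothesis but by a
reduction-type-free comparison of interpolation formulas (Hida's Rankin series in the BDP range, Katz,
class number formula); the typed statement is BCS's refereed sentence at every good `p > 2`, no more.
Siblings: `prop314_…_guarded` (ordinary, no (irr_K)), `prop627_…_supersingular_PRE` (`a_p = 0`, preprint,
no (irr_K)); neither implies nor is implied by this binder.
[cite: BurungaleCastellaSkinner2025, proof of Prop. 4.2.2 (§4.2, p. 9 L10–L13 of arXiv:2405.00270v2) with Prop. 4.2.2's hypotheses (p. 9 L2–L4), Conj. 4.1.2 (p. 8 L15–L24) and §1.2 (disc)/(Heeg)/(spl) (p. 2 L34–L39)]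
[cite: CastellaGrossiSkinner2025, Prop. 2.4.5 (= arXiv:2303.04373 Prop. 1.4.5, p. 9) and its proof, Def. 2.4.3 (= 1.4.3)]
[cite: Castella2018, Thm. 3.1 (the normalisation `IsBDPLFunction`)]
[cite: deShalit1987, II.4.12, II.4.16 (49)–(50) (the period pair (Ω, Ω_p), Ω ∈ ℂˣ, δ = √(±d_K))] -/
def proofProp422_span_minus_eq_span_bdp_goodReduction : Prop :=
  ∀ {p : ℕ} [Fact p.Prime] (ι : PadicAlgCl p ≃+* ℂ) (W : WeierstrassCurve ℚ) [W.IsElliptic]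
    [W.IsGloballyMinimal] (K : Type) [Field K] [NumberField K] (v vbar : HeightOneSpectrum (𝓞 K))
    (κ₁ κ₂ : ZpExtension K p) (γ₁ γ₂ : absoluteGaloisGroup K)
    [Fact (ZpExtension.IsTopGeneratorPair κ₁ κ₂ γ₁ γ₂)] {N : ℕ} [NeZero N]
    {f : CuspForm (Gamma0 N) 2} (_ : IsNewformOf W f) [NeZero (NumberField.discr K).natAbs],
    -- `g = f_E` of level `N = N_E`; `p > 2` of GOOD reduction (ordinary or supersingular)
    (N : ℤ) = W.conductorNorm ℤ → 2 < p → W.HasGoodReductionAtPrime p →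
    -- `K` imaginary quadratic; (Heeg); (spl); (disc); `(N, D_K) = 1`; (irr_K)
    IsImaginaryQuadratic K → SatisfiesHeegnerHypothesis N K →
    ((Ideal.span {(p : ℤ)}).primesOver (𝓞 K)).ncard = 2 →
    Odd (NumberField.discr K) → NumberField.discr K ≠ -3 → IsCoprime (N : ℤ) (NumberField.discr K) →
    (W.baseChange K).HasIrreducibleModPGaloisRep p →
    -- `v, v̄` the two primes above `p`, `v` the one induced by `ι`
    ((p : ℕ) : 𝓞 K) ∈ v.asIdeal → ((p : ℕ) : 𝓞 K) ∈ vbar.asIdeal → vbar ≠ v →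
    (∀ (w : InfinitePlace K) (k : 𝓞 K), k ∈ v.asIdeal ↔ ‖ι.symm (w.embedding (k : K))‖ < 1) →
    -- the `ℤ_p²`-tower in (cyclotomic, anticyclotomic) coordinates
    κ₁.IsCyclotomic → κ₂.IsAnticyclotomic →
    -- every Katz frame with GENUINE period data, and every Greenberg frame over it (print's `L_p^Gr(g/K)`)
    ∀ (Ω δ : ℂ) (Ωp : (unrIntegers p)ˣ) (LK G : PowerSeries (PowerSeries (PadicComplexInt p))),
      Ω ≠ 0 → (δ ^ 2 = (NumberField.discr K : ℂ) ∨ δ ^ 2 = -(NumberField.discr K : ℂ)) →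
      IsKatzMeasure₂ ι v vbar ∅ κ₁ κ₂ γ₁⁻¹ γ₂⁻¹ 1 Ω δ ((Ωp : unrIntegers p) : ℂ_[p]) LK →
      IsGreenbergLFunctionAnyRoot₂ ι v vbar κ₁ κ₂ γ₁⁻¹ γ₂⁻¹ f (NumberField.discr K).natAbs
        (NumberField.classNumber K) LK G →
    -- every BDP frame at the plain anticyclotomic generator (print's `L_p^BDP(g/K)`)
    ∀ (ΩK : ℂ) (Ωp' : (unrIntegers p)ˣ) (L : UnrSeries p), ΩK ≠ 0 →
      IsBDPLFunction ι v κ₂ γ₂ f ΩK ((Ωp' : unrIntegers p) : ℂ_[p]) L →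
    ∀ (J₀ : unrIntegers p →+* PadicComplexInt p),
      (∀ x : unrIntegers p, ((J₀ x : PadicComplexInt p) : ℂ_[p]) = (x : ℂ_[p])) →
      Ideal.span {minus G} = Ideal.span {PowerSeries.map J₀ L}

end Literature.NumberTheory.EllipticCurves.BurungaleCastellaSkinner2025

end
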